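import Literature.IUT.HodgeArakelov.ThetaGauLinks
import Literature.IUT.LogThetaLattice.PrimeStripFrame

/-!
# [IUTchII] Cor 4.10 over the prime-strip frame of [IUTchIII] §1 (bridge)

Merge bridge (abc-iut cell, layer L6; no re-typing of landed modules). `ThetaGauLinks.lean` ([IUTchII]
Cor 4.10/4.11, typed by the owner of this file) records the `Θ^{×μ}`- and `Θ^{×μ}_{gau}`-links over an INTERFACE
`ThetaLinkSetting FV FVM FUM DM` — four category parameters (the `F^⊩`-, `F^{⊩▶×μ}`-, `F^{⊢×μ}`-,
`D^⊢`-prime-strips) and three functors (`F^⊩ ↦ F^{⊩▶×μ} ↦ F^{⊢×μ} ↦ D^⊢`, [IUTchII] Def 4.9 (vi)–(viii),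
[IUTchI] Rmk 5.2.1 (i)) — together with two set-operations `polyIsoMap`, `polyIsoConj` on
poly-isomorphisms that predate the tree's `PolyIso.map` / `PolyIso.comp` / `PolyIso.single`
(`HodgeTheaters/PolyIsoFunctoriality.lean`). The canonical strip frame is now in the tree:
`Literature.IUT.LogThetaLattice.StripFrame` (`PrimeStripFrame.lean`, [IUTchIII] Def 1.1 frame: the
groupoids `Fgl`, `Fglxm`, `Fxm`, the category `Dv`, the functors `FglToFglxm`, `FglxmToFxm`, `FxmToDv`).
This file supplies:

* the dedup identities `polyIsoMap_eq_map` (`polyIsoMap Φ P = P.map Φ`) and `polyIsoConj_eq_comp`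
  (`polyIsoConj α P β = ((single α).comp P).comp (single β)`), so either vocabulary may be rewritten
  into the other ([IUTchI] §0 p. 33 poly-isomorphisms);
* `ThetaLinkSetting.ofStripFrame S` — the four parameters and three functors of Cor 4.10 ARE the
  corresponding fields of a `StripFrame`;
* over it: every `Θ^{×μ}`- or `Θ^{×μ}_{gau}`-link (a full poly-isomorphism of `F^{⊩▶×μ}`-prime-strips, Cor
  4.10 (iii) p. 160) is NONEMPTY (`StripFrame.iso_nonempty_Fglxm`, [IUTchII] Def 4.9 (viii)), and the
  coricity statement of Cor 4.10 (iv) p. 160 (`HodgeTheaterStrips.UnitMuCoric`: "one obtains a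
  poly-isomorphism `†F^{⊢×μ}_△ ⥲ ‡F^{⊢×μ}_△` which coincides with the full poly-isomorphism") FOLLOWS from
  the frame-level property "`F^{⊩▶×μ} ↦ F^{⊢×μ}` carries full poly-isomorphisms onto full
  poly-isomorphisms" (`unitMuCoric_of_map_full`) — the exact shape in which the [IUTchIII]-side typing
  records Cor 4.10 (iv).

S. Mochizuki, *Inter-universal Teichmüller theory II*, kurims Dec-2020 manuscript, Cor 4.10 pp. 158–161;
*I*, kurims May-2020 manuscript, §0 p. 33. Claim key `Mochizuki2012` DISPUTED (D-0012): bookkeeping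
over interfaces only; nothing here asserts a disputed claim or takes a side on [IUTchIII] Cor 3.12.
-/

namespace Literature.IUT.HodgeArakelov

open CategoryTheory
open Literature.IUT.HodgeTheaters (PolyIso)
open Literature.IUT.LogThetaLattice

universe v u v' u'

/-! ### 1. `polyIsoMap` / `polyIsoConj` versus `PolyIso.map` / `PolyIso.comp` / `PolyIso.single` -/

section Poly

variable {C : Type u} [Category.{v} C]

/-- `polyIsoMap Φ P` IS the image poly-isomorphism `P.map Φ` of [IUTchI] §0 p. 33 ("induces a
poly-isomorphism") as typed in `PolyIsoFunctoriality`. [cite: Mochizuki2012, §0 p.33] -/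
theorem polyIsoMap_eq_map {D : Type u'} [Category.{v'} D] (Φ : C ⥤ D) {X Y : C} (P : PolyIso X Y) :
    polyIsoMap Φ P = P.map Φ := by
  ext φ
  simp only [polyIsoMap, Set.mem_setOf_eq, PolyIso.mem_map]
  constructor
  · rintro ⟨ψ, hψ, rfl⟩; exact ⟨ψ, hψ, rfl⟩
  · rintro ⟨ψ, hψ, rfl⟩; exact ⟨ψ, hψ, rfl⟩

/-- `polyIsoConj α P β` IS the composite poly-isomorphism `{α} ∘ P ∘ {β}` of [IUTchI] §0 p. 33
("`{g_j ∘ f_i}`") as typed in `PolyIsoFunctoriality`. [cite: Mochizuki2012, §0 p.33] -/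
theorem polyIsoConj_eq_comp {X X' Y Y' : C} (α : X' ≅ X) (P : PolyIso X Y) (β : Y ≅ Y') :
    polyIsoConj α P β = ((PolyIso.single α).comp P).comp (PolyIso.single β) := by
  ext φ
  simp only [polyIsoConj, Set.mem_setOf_eq, PolyIso.mem_comp, PolyIso.mem_single, exists_eq_left]
  constructor
  · rintro ⟨ψ, hψ, rfl⟩
    exact ⟨α ≪≫ ψ, ⟨ψ, hψ, rfl⟩, by rw [Iso.trans_assoc]⟩
  · rintro ⟨_, ⟨ψ, hψ, rfl⟩, rfl⟩
    exact ⟨ψ, hψ, by rw [Iso.trans_assoc]⟩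

/-- A functor carrying FULL poly-isomorphisms `X ⥲ Y` onto full ones is surjective on isomorphisms
`X ≅ Y` (and conversely) — the two phrasings of [IUTchI] Cor 5.3 (iii) p. 144 "the natural map
`Isom(−,−) → Isom(−,−)` … is surjective". [cite: Mochizuki2012, Cor 5.3 (iii) p.144] -/
theorem mapIso_surjective_iff_map_full {D : Type u'} [Category.{v'} D] (Φ : C ⥤ D) (X Y : C) :
    Function.Surjective (Φ.mapIso : (X ≅ Y) → (Φ.obj X ≅ Φ.obj Y)) ↔
      (PolyIso.full X Y).map Φ = PolyIso.full _ _ := by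
  constructor
  · intro h
    ext e
    simp only [PolyIso.mem_map, PolyIso.mem_full, true_and, iff_true]
    exact h e
  · intro h e
    have he : e ∈ (PolyIso.full X Y).map Φ := by rw [h]; exact PolyIso.mem_full e
    obtain ⟨f, -, rfl⟩ := PolyIso.mem_map.mp he
    exact ⟨f, rfl⟩

end Poly

/-! ### 2. The setting of Cor 4.10 from a strip frame -/

/-- **The categories and functors of [IUTchII] Cor 4.10 (pp. 158–161) ARE fields of the strip frame**
([IUTchIII] Def 1.1 frame as typed in `PrimeStripFrame`): `F^⊩`-prime-strips `Fgl` ([IUTchI] Def 5.2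
(iv)), `F^{⊩▶×μ}` `Fglxm` and `F^{⊢×μ}` `Fxm` ([IUTchII] Def 4.9 (vii),(viii)), `D^⊢` `Dv` ([IUTchI] Def 4.1
(iv)), with `F^⊩ ↦ F^{⊩▶×μ}` = `FglToFglxm`, `F^{⊩▶×μ} ↦ F^{⊢×μ}` = `FglxmToFxm`, `F^{⊢×μ} ↦ D^⊢` = `FxmToDv`.
[cite: Mochizuki2012, Cor 4.10 (iii) p.160] -/
def ThetaLinkSetting.ofStripFrame (S : StripFrame.{u}) : ThetaLinkSetting S.Fgl S.Fglxm S.Fxm S.Dv where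
  toVdashMu := S.FglToFglxm
  toUnitMu := S.FglxmToFxm
  toDMono := S.FxmToDv

namespace ThetaLinkSetting

variable (S : StripFrame.{u})

/-- `F^⊩ ↦ F^{⊩▶×μ}` of the induced setting is the frame's `FglToFglxm` ([IUTchII] Def 4.9 (viii)).
[cite: Mochizuki2012, Def 4.9 (viii) p.158] -/
@[simp] theorem ofStripFrame_toVdashMu : (ofStripFrame S).toVdashMu = S.FglToFglxm := rfl

/-- `F^{⊩▶×μ} ↦ F^{⊢×μ}` of the induced setting is the frame's `FglxmToFxm` ([IUTchII] Def 4.9 (vi)–(viii)).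
[cite: Mochizuki2012, Def 4.9 (vii) p.158] -/
@[simp] theorem ofStripFrame_toUnitMu : (ofStripFrame S).toUnitMu = S.FglxmToFxm := rfl

/-- `F^{⊢×μ} ↦ D^⊢` of the induced setting is the frame's `FxmToDv` ([IUTchII] Def 4.9 (vii)).
[cite: Mochizuki2012, Def 4.9 (vii) p.158] -/
@[simp] theorem ofStripFrame_toDMono : (ofStripFrame S).toDMono = S.FxmToDv := rfl

end ThetaLinkSetting

/-! ### 3. Cor 4.10 (iii)/(iv) over a strip frame -/

namespace HodgeTheaterStrips

variable {S : StripFrame.{u}} (dag ddag : HodgeTheaterStrips (ThetaLinkSetting.ofStripFrame S))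

/-- Cor 4.10 (iii) p. 160 over a strip frame: the `Θ^{×μ}`-link `†F^{⊩▶×μ}_env ⥲ ‡F^{⊩▶×μ}_△` is a NONEMPTY
(full) poly-isomorphism — any two `F^{⊩▶×μ}`-prime-strips are isomorphic ([IUTchII] Def 4.9 (viii),
`StripFrame.iso_nonempty_Fglxm`). [cite: Mochizuki2012, Cor 4.10 (iii) p.160] -/
theorem thetaTimesMuLink_nonempty : (dag.thetaTimesMuLink ddag).Nonempty := by
  obtain ⟨e⟩ := S.iso_nonempty_Fglxm (S.FglToFglxm.obj dag.env) (S.FglToFglxm.obj ddag.delta)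
  exact ⟨e, Set.mem_univ _⟩

/-- Cor 4.10 (iii) p. 160 over a strip frame: the `Θ^{×μ}_{gau}`-link `†F^{⊩▶×μ}_gau ⥲ ‡F^{⊩▶×μ}_△` is
NONEMPTY. [cite: Mochizuki2012, Cor 4.10 (iii) p.160] -/
theorem thetaTimesMuGauLink_nonempty : (dag.thetaTimesMuGauLink ddag).Nonempty := by
  obtain ⟨e⟩ := S.iso_nonempty_Fglxm (S.FglToFglxm.obj dag.gau) (S.FglToFglxm.obj ddag.delta)
  exact ⟨e, Set.mem_univ _⟩

/-- **Cor 4.10 (iv) p. 160 over a strip frame, reduced to a frame-level property.** If the functor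
`F^{⊩▶×μ} ↦ F^{⊢×μ}` of the frame carries full poly-isomorphisms onto full poly-isomorphisms (the shape
"the natural map `Isom → Isom` is surjective" of [IUTchI] Cor 5.3 (iii)), then "`(−)F^{⊢×μ}_△` is an
invariant of both the `Θ^{×μ}`- and `Θ^{×μ}_{gau}`-links": the induced poly-isomorphisms
`†F^{⊢×μ}_△ ⥲ ‡F^{⊢×μ}_△` coincide with the full poly-isomorphism (`UnitMuCoric`).
[cite: Mochizuki2012, Cor 4.10 (iv) p.160] -/
theorem unitMuCoric_of_map_full
    (h : ∀ X Y : S.Fglxm, (PolyIso.full X Y).map S.FglxmToFxm = PolyIso.full _ _) :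
    dag.UnitMuCoric ddag :=
  dag.unitMuCoric_of_mapIso_surjective ddag
    ((mapIso_surjective_iff_map_full S.FglxmToFxm _ _).mpr (h _ _))
    ((mapIso_surjective_iff_map_full S.FglxmToFxm _ _).mpr (h _ _))

/-- The poly-isomorphism of Cor 4.10 (iv) through the `Θ^{×μ}`-link, in the tree's `PolyIso` vocabulary:
`{†F^{⊢×μ}_△ ⥲ †F^{⊢×μ}_env} ∘ (Θ^{×μ}-link).map(F^{⊩▶×μ} ↦ F^{⊢×μ}) ∘ {id}`. [cite: Mochizuki2012, Cor 4.10 (iv) p.160] -/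
theorem unitMuPolyIso_eq_comp :
    dag.unitMuPolyIso ddag =
      ((PolyIso.single dag.unitDeltaIsoEnv).comp ((dag.thetaTimesMuLink ddag).map S.FglxmToFxm)).comp
        (PolyIso.single (Iso.refl _)) := by
  rw [unitMuPolyIso, polyIsoConj_eq_comp, polyIsoMap_eq_map]
  rfl

/-- The `D`-`Θ^{±ell}NF`-link of Cor 4.10 (iv) p. 160 over a strip frame is the full poly-isomorphism of
`D^⊢`-prime-strips `FxmToDv(FglxmToFxm(FglToFglxm †F^⊩_△)) ⥲ …` (by definition). [cite: Mochizuki2012, Cor 4.10 (iv) p.160] -/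
theorem dLink_eq_full :
    dag.dLink ddag =
      PolyIso.full (S.FxmToDv.obj (S.FglxmToFxm.obj (S.FglToFglxm.obj dag.delta)))
        (S.FxmToDv.obj (S.FglxmToFxm.obj (S.FglToFglxm.obj ddag.delta))) := rfl

end HodgeTheaterStrips

end Literature.IUT.HodgeArakelov
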